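import Literature.AlgebraicGeometry.Resolution.FormalFibresCriterion
import Literature.AlgebraicGeometry.Resolution.RegularFibreByDerivation
import Literature.AlgebraicGeometry.Resolution.ArtinApproximationAffineLemmas
import Mathlib.RingTheory.Localization.LocalizationLocalization
import Mathlib.RingTheory.Localization.BaseChange
import Mathlib.RingTheory.Flat.Stability
import HarnessLib

/-!
# Formal fibres along a finite algebra over a local ring: the engine of Stacks 07PU

Topic: `Literature/AlgebraicGeometry/Resolution`. Generic commutative algebra for the case
`𝔯 ≠ (0)` in characteristic `p` of Grothendieck's theorem "`R` a G-ring ⇒ `R[x]` a G-ring" (The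
Stacks Project, Tag 07PV = Proposition 15.51.10, through Tag 07PU = Lemma 15.51.9, and Matsumura,
*Commutative Ring Theory*, proof of Thm. 32.5, p. 260). In that proof one must show that
`L ⊗_S Ŝ` is a regular ring, for `S` a local ring of the polynomial ring, `Ŝ` its completion and
`L` a finite extension of a residue field `κ(𝔭)` of `S`; `L` is made into an algebra over a
finite `S`-algebra `C` (a localisation of `B[x]`, `B ⊆ L` finite over the coefficient ring), and
`L ⊗_S Ŝ = L ⊗_C (C ⊗_S Ŝ) = Π_𝔫 L ⊗_C (C_𝔫)^` (Stacks 07N9), each factor being either zero or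
the formal fibre of `C_𝔫` over the prime `𝔨 = ker (C → L)`, whose regularity comes from a
derivation (Matsumura Thm. 30.4 (ii)). This file PROVES the generic pieces of that computation;
the polynomial-specific assembly is elsewhere. Everything is PROVED; no new notions, no named
facts.

## Content (namespace `Literature.AlgebraicGeometry.Resolution`)

* `isRegularRing_tensor_adicCompletion_of_forall_maximal` — **`L ⊗_S Ŝ` is regular as soon as
  all the `L ⊗_C (C_𝔫)^` are** (`C` finite over the Noetherian local ring `S`, `L` any
  `C`-algebra; converse companion of `isRegularRing_tensor_completion_localization`).
* `subsingleton_tensor_of_isUnit` — the factors at the `𝔫` not containing `𝔨` vanish (and the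
  zero ring is regular, `isRegularRing_of_subsingleton` of `ArtinApproximationAffineLemmas.lean`).
* `isRegularRing_tensor_of_isRegularRing_fiber` — for a field `L` which is the fraction field
  of `C/𝔨`, `L ⊗_C X` is the fibre ring `κ(𝔨) ⊗_C X`.
* `isRegularLocalRing_quotient_localization_of_derivation`, `isRegularRing_fiber_of_derivation'`
  — **Matsumura Thm. 30.4 (ii) in the fibre**: for a height-one prime `𝔨` of `C`, `g ∈ 𝔨` and a
  derivation `D` of a flat Noetherian `C`-algebra `X` with `v·D(g) ≡ c (mod g)`, `c ∈ C ∖ 𝔨`,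
  the rings `X_𝔔/𝔨X_𝔔` (`𝔔 ∩ C = 𝔨`, `X_𝔔` regular) are regular, hence so is `κ(𝔨) ⊗_C X`.
* `isRegularLocalRing_localization_of_isLocalization_of_disjoint` — the local rings of `T` at
  primes avoiding `N` are regular when `N⁻¹T` is.
* `isRegularLocalRing_localization_completion_of_forall_disjoint` — **the local rings of
  `(C_𝔫)^` at primes avoiding a submonoid `N ⊇ C ∖ 𝔫` are regular as soon as those of
  `C ⊗_S Ŝ` are** (`(C_𝔫)^` is a factor of `C ⊗_S Ŝ`).

## Sources

* The Stacks Project, Tags 07PU (Lemma 15.51.9, proof), 07N9 (Lemma 10.97.8), 07PP (proof).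
  [StacksProject]
* H. Matsumura, *Commutative Ring Theory*, CUP 1986, Thm. 30.4 (ii) p. 233; proof of Thm. 32.5,
  p. 260 ("`C* = B_1* × ⋯ × B_r*` … we can identify any local ring of `A* ⊗_A L = C* ⊗_C L` with
  the localisation `(B_i*)_Q`"). [Matsumura1987]
-/

noncomputable section

open IsLocalRing TensorProduct

namespace Literature.AlgebraicGeometry.Resolution

universe u

/-! ## `L ⊗_S Ŝ` from its factors `L ⊗_C (C_𝔫)^` -/

section Engine

variable (S C M : Type u) [CommRing S] [CommRing C] [CommRing M] [Algebra S C] [IsLocalRing S]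
  [IsNoetherianRing S] [Module.Finite S C] [Algebra C M] [Algebra S M] [IsScalarTower S C M]

/-- **`L ⊗_S Ŝ` is a regular ring as soon as all the `L ⊗_C (C_𝔫)^` are**, for `C` finite over the
Noetherian local ring `S`, `Ŝ` its completion, `L` any `C`-algebra and `𝔫` running over the
(finitely many) maximal ideals of `C`: `L ⊗_S Ŝ = L ⊗_C (C ⊗_S Ŝ) = L ⊗_C Π_𝔫 (C_𝔫)^ =
Π_𝔫 L ⊗_C (C_𝔫)^` (Stacks 07N9, `Stacks07N9_local`), and a finite product of regular rings is
regular. This is the computation "`C* = A* ⊗_A C = B_1* × ⋯ × B_r*`, … `A* ⊗_A L = C* ⊗_C L`" of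
Matsumura's proof of Thm. 32.5. [cite: Matsumura1987, Thm. 32.5, proof p. 260] -/
theorem isRegularRing_tensor_adicCompletion_of_forall_maximal
    (h : ∀ n : MaximalSpectrum C, IsRegularRing
      (M ⊗[C] AdicCompletion (maximalIdeal (Localization.AtPrime n.asIdeal))
        (Localization.AtPrime n.asIdeal))) :
    IsRegularRing (M ⊗[S] AdicCompletion (maximalIdeal S) S) := by
  classical
  haveI : Fintype (MaximalSpectrum C) :=
    @Fintype.ofFinite _ (finite_maximalSpectrum_of_finite S C)
  let P : MaximalSpectrum C → Type u := fun n' =>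
    M ⊗[C] AdicCompletion (maximalIdeal (Localization.AtPrime n'.asIdeal))
      (Localization.AtPrime n'.asIdeal)
  haveI : ∀ n', IsRegularRing (P n') := h
  haveI hprod : IsRegularRing (∀ n', P n') := isRegularRing_pi P
  let e₂ := Algebra.TensorProduct.piRight C M M fun n' : MaximalSpectrum C =>
    AdicCompletion (maximalIdeal (Localization.AtPrime n'.asIdeal)) (Localization.AtPrime n'.asIdeal)
  let e₃ := Algebra.TensorProduct.congr (AlgEquiv.refl (R := M) (A₁ := M)) (Stacks07N9_local S C).symm
  let e₄ := Algebra.TensorProduct.cancelBaseChange S C M M (AdicCompletion (maximalIdeal S) S)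
  exact IsRegularRing.of_ringEquiv (R := ∀ n', P n') ((e₃.trans e₄).symm.trans e₂).symm.toRingEquiv

end Engine

/-! ## Vanishing factors -/

section Vanishing

/-- If `c ∈ C` dies in the `C`-algebra `M` and becomes a unit in the `C`-algebra `X`, then
`M ⊗_C X = 0`. [folklore] -/
theorem subsingleton_tensor_of_isUnit {C M X : Type u} [CommRing C] [CommRing M] [CommRing X]
    [Algebra C M] [Algebra C X] (c : C) (hc : algebraMap C M c = 0)
    (hu : IsUnit (algebraMap C X c)) : Subsingleton (M ⊗[C] X) := by
  obtain ⟨u, hu⟩ := hu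
  refine subsingleton_of_zero_eq_one ?_
  have h1 : (1 : M ⊗[C] X) = (1 : M) ⊗ₜ[C] ((↑u⁻¹ : X) * algebraMap C X c) := by
    rw [← hu, Units.inv_mul, Algebra.TensorProduct.one_def]
  have h2 : (1 : M) ⊗ₜ[C] ((↑u⁻¹ : X) * algebraMap C X c) = 0 := by
    rw [Algebra.algebraMap_eq_smul_one, mul_smul_comm, mul_one, tmul_smul, smul_tmul',
      ← Algebra.algebraMap_eq_smul_one, hc, zero_tmul]
  rw [h1, h2]

end Vanishing

/-! ## `L ⊗_C X` is the fibre ring over `𝔨 = ker (C → L)` when `L = Frac(C/𝔨)` -/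

section Bridge

variable {C : Type u} [CommRing C] (I : Ideal C) [I.IsPrime] (L : Type u) [Field L] [Algebra C L]
  (hker : RingHom.ker (algebraMap C L) = I)
  (hfrac : ∀ ℓ : L, ∃ a b : C, algebraMap C L b ≠ 0 ∧ ℓ * algebraMap C L b = algebraMap C L a)

include hker hfrac in
/-- For a field `L` and `C → L` with kernel `𝔨` such that `L` consists of the fractions of the
image: `κ(𝔨) ≃ L` over `C`. [folklore] -/
theorem exists_residueField_algEquiv_of_ker :
    ∃ e : I.ResidueField ≃ₐ[C] L, ∀ c : C, e (algebraMap C I.ResidueField c) = algebraMap C L c := by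
  have hf₁ : I ≤ RingHom.ker (Algebra.ofId C L) := fun c hc => by
    change c ∈ RingHom.ker (algebraMap C L)
    rwa [hker]
  have hf₂ : I.primeCompl ≤ (IsUnit.submonoid L).comap (Algebra.ofId C L : C →+* L) := by
    intro c hc
    have hc' : c ∉ I := hc
    change IsUnit (algebraMap C L c)
    refine isUnit_iff_ne_zero.mpr fun h0 => hc' ?_
    rw [← hker, RingHom.mem_ker]
    exact h0
  let φ : I.ResidueField →ₐ[C] L := Ideal.ResidueField.liftₐ I (Algebra.ofId C L) hf₁ hf₂
  have hφ : ∀ c : C, φ (algebraMap C I.ResidueField c) = algebraMap C L c := fun c =>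
    Ideal.ResidueField.liftₐ_algebraMap I (Algebra.ofId C L) hf₁ hf₂ c
  have hbij : Function.Bijective φ := by
    refine ⟨φ.toRingHom.injective, fun ℓ => ?_⟩
    obtain ⟨a, b, hb, hab⟩ := hfrac ℓ
    refine ⟨algebraMap C _ a * (algebraMap C _ b)⁻¹, ?_⟩
    rw [map_mul, map_inv₀, hφ, hφ, ← hab, mul_inv_cancel_right₀ hb]
  exact ⟨AlgEquiv.ofBijective φ hbij, hφ⟩

include hker hfrac in
/-- **`L ⊗_C X` is regular iff the fibre ring `κ(𝔨) ⊗_C X` is**, for `L = Frac(C/𝔨)` as above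
(the two rings are isomorphic). [folklore] -/
theorem isRegularRing_tensor_of_isRegularRing_fiber (X : Type u) [CommRing X] [Algebra C X]
    (h : IsRegularRing (I.Fiber X)) : IsRegularRing (L ⊗[C] X) := by
  obtain ⟨e, -⟩ := exists_residueField_algEquiv_of_ker I L hker hfrac
  exact IsRegularRing.of_ringEquiv (R := I.Fiber X)
    (Algebra.TensorProduct.congr e (AlgEquiv.refl (R := C) (A₁ := X))).toRingEquiv

end Bridge

/-! ## Matsumura Thm. 30.4 (ii) in a fibre over a height-one prime -/

section Derivation

variable {T : Type u} [CommRing T] [IsNoetherianRing T] (S : Type u) [CommRing S]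
  [IsNoetherianRing S] [Algebra T S] [Module.Flat T S] (I : Ideal T) [I.IsPrime]
  (hht : I.height = 1) (g : T) (hg : g ∈ I) (D : Derivation ℤ S S)
  (hD : ∃ (v : S) (c : T), c ∉ I ∧
    v * D (algebraMap T S g) - algebraMap T S c ∈ Ideal.span {algebraMap T S g})

include hht hg hD in
/-- **The closed fibre `S_𝔔/𝔨S_𝔔` over a height-one prime `𝔨` is regular when a derivation
detects `g ∈ 𝔨`** (the `d/dx`-step of Stacks 07PU, through Matsumura Thm. 30.4 (ii), cf.
`isRegularRing_fiber_of_derivation`): `T` Noetherian, `S` a flat Noetherian `T`-algebra,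
`ht 𝔨 = 1`, `g ∈ 𝔨`, `D ∈ Der(S)` with `v·D(g) ≡ c (mod gS)` for some `c ∈ T ∖ 𝔨`; then for every
prime `𝔔` of `S` over `𝔨` at which `S` is regular, `S_𝔔/𝔨S_𝔔` is a regular local ring (and
`𝔨S_𝔔 = gS_𝔔`). Indeed `D(g) ∉ 𝔔` and `ht 𝔨S_𝔔 = 1` by going down.
[cite: Matsumura1987, Thm. 30.4 (ii)] -/
theorem isRegularLocalRing_quotient_localization_of_derivation (𝔔 : Ideal S) [𝔔.IsPrime]
    (h𝔔 : 𝔔.under T = I) [IsRegularLocalRing (Localization.AtPrime 𝔔)] :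
    IsRegularLocalRing
      (Localization.AtPrime 𝔔 ⧸ I.map (algebraMap T (Localization.AtPrime 𝔔))) := by
  classical
  obtain ⟨v, c, hc, hvc⟩ := hD
  set A := Localization.AtPrime 𝔔
  set J : Ideal S := I.map (algebraMap T S) with hJ
  have hJ𝔔 : J ≤ 𝔔 := by
    rw [hJ, Ideal.map_le_iff_le_comap, ← Ideal.under_def, h𝔔]
  have hgJ : algebraMap T S g ∈ J := Ideal.mem_map_of_mem _ hg
  -- flatness of `T → S → S_𝔔`, so `ht 𝔨S_𝔔 = ht 𝔨 = 1`
  haveI : Module.Flat T A := Module.Flat.trans T S A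
  have hmapA : J.map (algebraMap S A) = I.map (algebraMap T A) := by
    rw [hJ, Ideal.map_map, ← IsScalarTower.algebraMap_eq T S A]
  have hne : I.map (algebraMap T A) ≠ ⊤ := by
    intro htop
    have hle : I.map (algebraMap T A) ≤ maximalIdeal A := by
      rw [← hmapA, ← Localization.AtPrime.map_eq_maximalIdeal]
      exact Ideal.map_mono hJ𝔔
    exact (maximalIdeal.isMaximal A).ne_top (top_le_iff.mp (htop ▸ hle))
  have hIA : (J.map (algebraMap S A)).height = 1 := by
    rw [hmapA, height_map_eq_of_hasGoingDown I hne, hht]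
  -- `D(g) ∉ 𝔔`: otherwise `c ∈ 𝔔 ∩ T = 𝔨`
  have hDg : D (algebraMap T S g) ∉ 𝔔 := by
    intro hDg
    apply hc
    have h1 : v * D (algebraMap T S g) - algebraMap T S c ∈ 𝔔 :=
      (Ideal.span_le.mpr (Set.singleton_subset_iff.mpr (hJ𝔔 hgJ))) hvc
    have h2 : algebraMap T S c ∈ 𝔔 := by
      have h := 𝔔.sub_mem (𝔔.mul_mem_left v hDg) h1
      rwa [sub_sub_cancel] at h
    rw [← h𝔔, Ideal.under_def, Ideal.mem_comap]
    exact h2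
  have hdet : (Matrix.of fun (_ : Fin 1) (_ : Fin 1) => D (algebraMap T S g)).det ∉ 𝔔 := by
    rwa [Matrix.det_unique, Matrix.of_apply]
  -- Matsumura Thm. 30.4 (ii) with `r = 1`, `f₁ = g`, `D₁ = D`
  have key := map_eq_span_and_isRegularLocalRing_quotient_of_det_not_mem 𝔔 A J hJ𝔔 1 hIA
    (fun _ => D) (fun _ => algebraMap T S g) (fun _ => hgJ) hdet
  rw [← hmapA]
  exact key.2

include hht hg hD in
/-- **The fibre ring `κ(𝔨) ⊗_T S` over a height-one prime `𝔨` is regular when a derivation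
detects `g ∈ 𝔨`** and `S` is regular at the primes over `𝔨` (the local rings of the fibre ring
are the `S_𝔔/𝔨S_𝔔`, `isRegularRing_fiber_of_forall`). [cite: StacksProject, Tag 07PU (proof)] -/
theorem isRegularRing_fiber_of_derivation'
    (hreg : ∀ (𝔔 : Ideal S) [𝔔.IsPrime], 𝔔.under T = I →
      IsRegularLocalRing (Localization.AtPrime 𝔔)) :
    IsRegularRing (I.Fiber S) := by
  refine isRegularRing_fiber_of_forall I fun 𝔔 _ h𝔔 => ?_
  haveI := hreg 𝔔 h𝔔
  exact isRegularLocalRing_quotient_localization_of_derivation S I hht g hg D hD 𝔔 h𝔔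

end Derivation

/-! ## Regular local rings of a regular localisation -/

section LocalRings

/-- **If the localisation `W = N⁻¹T` is a regular ring, then `T_𝔮` is a regular local ring for
every prime `𝔮` of `T` not meeting `N`** (`T_𝔮` is the local ring of `W` at `𝔮W`). [folklore] -/
theorem isRegularLocalRing_localization_of_isLocalization_of_disjoint {T W : Type u} [CommRing T]
    [CommRing W] [Algebra T W] (N : Submonoid T) [IsLocalization N W] [IsRegularRing W]
    (q : Ideal T) [hq : q.IsPrime] (hdisj : Disjoint (N : Set T) q) :
    IsRegularLocalRing (Localization.AtPrime q) := by
  set Q : Ideal W := q.map (algebraMap T W) with hQ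
  haveI : Q.IsPrime := IsLocalization.isPrime_of_isPrime_disjoint N W q hq hdisj
  have hQq : Q.comap (algebraMap T W) = q := by
    rw [← Ideal.under_def]
    exact IsLocalization.under_map_of_isPrime_disjoint N W hq hdisj
  haveI : IsLocalization.AtPrime (Localization.AtPrime Q) (Q.comap (algebraMap T W)) :=
    IsLocalization.isLocalization_isLocalization_atPrime_isLocalization N (Localization.AtPrime Q) Q
  have hM : (Q.comap (algebraMap T W)).primeCompl = q.primeCompl :=
    Submonoid.ext fun x => by rw [Ideal.mem_primeCompl_iff, Ideal.mem_primeCompl_iff, hQq]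
  haveI : IsLocalization.AtPrime (Localization.AtPrime Q) q := by
    change IsLocalization q.primeCompl _
    rw [← hM]
    infer_instance
  exact IsRegularLocalRing.of_ringEquiv
    (IsLocalization.algEquiv q.primeCompl (Localization.AtPrime Q)
      (Localization.AtPrime q)).toRingEquiv

end LocalRings

/-! ## The local rings of `(C_𝔫)^` at primes avoiding `N`, from those of `C ⊗_S Ŝ` -/

section Factor

variable (S C : Type u) [CommRing S] [CommRing C] [Algebra S C] [IsLocalRing S]
  [IsNoetherianRing S] [Module.Finite S C] (n : Ideal C) [hn : n.IsMaximal]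
  (N : Submonoid C) (hN : n.primeCompl ≤ N)

include hN in
/-- **The local rings of `(C_𝔫)^` at the primes avoiding a submonoid `N ⊇ C ∖ 𝔫` are regular as
soon as the local rings of `C ⊗_S Ŝ` at the primes avoiding `N` are** (`C` finite over the
Noetherian local ring `S`, `𝔫` a maximal ideal of `C`): with `L' = N⁻¹C`, an algebra over `C_𝔫`,
`L' ⊗_S Ŝ = L' ⊗_C (C ⊗_S Ŝ) = N⁻¹(C ⊗_S Ŝ)` is regular (its local rings are the given ones), so
its factor `L' ⊗_{C_𝔫} (C_𝔫)^ = N⁻¹(C_𝔫)^` (`isRegularRing_tensor_completion_localization`, Stacks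
07N9/07PP) is regular, and the local rings of `(C_𝔫)^` at primes avoiding `N` are local rings of
it. [cite: StacksProject, Tag 07PP (proof)] -/
theorem isRegularLocalRing_localization_completion_of_forall_disjoint
    (hreg : ∀ (𝔓 : Ideal (C ⊗[S] AdicCompletion (maximalIdeal S) S)) [𝔓.IsPrime],
      (∀ x ∈ N, algebraMap C (C ⊗[S] AdicCompletion (maximalIdeal S) S) x ∉ 𝔓) →
        IsRegularLocalRing (Localization.AtPrime 𝔓))
    (𝔔 : Ideal (AdicCompletion (maximalIdeal (Localization.AtPrime n)) (Localization.AtPrime n)))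
    [𝔔.IsPrime]
    (h𝔔 : ∀ x ∈ N, algebraMap C (AdicCompletion (maximalIdeal (Localization.AtPrime n))
      (Localization.AtPrime n)) x ∉ 𝔔) :
    IsRegularLocalRing (Localization.AtPrime 𝔔) := by
  -- notation
  let Sh := AdicCompletion (maximalIdeal S) S
  let Cn := Localization.AtPrime n
  let X := AdicCompletion (maximalIdeal Cn) Cn
  let L' := Localization N
  haveI : IsNoetherianRing C := IsNoetherianRing.of_finite S C
  haveI : IsNoetherianRing (C ⊗[S] Sh) := by
    haveI : IsNoetherianRing Sh := isNoetherianRing_adicCompletion_maximalIdeal S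
    haveI : IsNoetherianRing (Sh ⊗[S] C) :=
      isNoetherian_of_tower Sh (inferInstance : IsNoetherian Sh (Sh ⊗[S] C))
    exact isNoetherianRing_of_ringEquiv (Sh ⊗[S] C) (Algebra.TensorProduct.comm S Sh C).toRingEquiv
  -- `L' = N⁻¹C` as an algebra over `C_𝔫`
  letI : Algebra Cn L' := IsLocalization.localizationAlgebraOfSubmonoidLe Cn L' n.primeCompl N hN
  haveI : IsScalarTower C Cn L' := IsLocalization.localization_isScalarTower_of_submonoid_le Cn L'
    n.primeCompl N hN
  haveI hL'loc : IsLocalization (N.map (algebraMap C Cn)) L' :=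
    IsLocalization.isLocalization_of_submonoid_le Cn L' n.primeCompl N hN
  -- `L' ⊗_C (C ⊗_S Ŝ) = N⁻¹(C ⊗_S Ŝ)` is regular
  have h1 : IsRegularRing (L' ⊗[C] (C ⊗[S] Sh)) := by
    letI : Algebra (C ⊗[S] Sh) (L' ⊗[C] (C ⊗[S] Sh)) := Algebra.TensorProduct.rightAlgebra
    haveI : IsLocalization (Algebra.algebraMapSubmonoid (C ⊗[S] Sh) N) (L' ⊗[C] (C ⊗[S] Sh)) :=
      IsLocalization.tensorRight L' N
    refine isRegularRing_of_isLocalization_of_forall (Algebra.algebraMapSubmonoid (C ⊗[S] Sh) N)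
      fun 𝔓 _ hdisj => hreg 𝔓 fun x hx hmem => ?_
    exact Set.disjoint_left.mp hdisj ⟨x, hx, rfl⟩ hmem
  -- hence `L' ⊗_S Ŝ` is regular, and its factor `L' ⊗_{C_𝔫} X`
  have h2 : IsRegularRing (L' ⊗[S] Sh) :=
    @IsRegularRing.of_ringEquiv _ _ _ _
      (Algebra.TensorProduct.cancelBaseChange S C C L' Sh).toRingEquiv h1
  have h3 : IsRegularRing (L' ⊗[Cn] X) := isRegularRing_tensor_completion_localization S C L' n h2
  haveI h4 : IsRegularRing (X ⊗[Cn] L') :=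
    @IsRegularRing.of_ringEquiv _ _ _ _ (Algebra.TensorProduct.comm Cn L' X).toRingEquiv h3
  -- `X ⊗_{C_𝔫} L'` is the localisation of `X` at the image of `N`
  haveI : IsLocalization (Algebra.algebraMapSubmonoid X (N.map (algebraMap C Cn))) (X ⊗[Cn] L') :=
    IsLocalization.tensor L' (N.map (algebraMap C Cn))
  refine isRegularLocalRing_localization_of_isLocalization_of_disjoint (W := X ⊗[Cn] L')
    (Algebra.algebraMapSubmonoid X (N.map (algebraMap C Cn))) 𝔔 ?_
  haveI := isScalarTower_adicCompletion_localization C n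
  rw [Set.disjoint_left]
  rintro _ ⟨_, ⟨x, hx, rfl⟩, rfl⟩ hmem
  exact h𝔔 x hx (by rwa [IsScalarTower.algebraMap_apply C Cn X x])

end Factor

end Literature.AlgebraicGeometry.Resolution

end
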